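import Summits.RiemannHypothesis.RiemannHypothesis.Theorems.SemilocalLogAtomsD
import HarnessLib

/-!
# Semi-local negative certificates: the atoms `67, 71` (enclosures, once and for all)

Cell `rh-explicit` (HOME `run/shared/lean/pub/rh-explicit/`), seat cc-s2-4 gen8 (A4-EXT, the Lean side: atom tables for the walls
`q = 67, 73` on the WIDE windows `b ≤ 4` of `SemilocalNegCertWide.lean`; `log 71` also bounds `log (N+1)` for the `q = 67` window).
Companion of `SemilocalLogAtoms{,B,C,D}.lean` (atoms `2 … 64`): the rational atom table entries `(n, lo, hi, wlo, whi)` for the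
primes `67, 71`, each with its enclosure lemma for an ARBITRARY `S` containing the prime:

* `log 67` (2.2e-10), `log 71` (4.1e-10) by Mathlib's `Real.abs_log_sub_add_sum_range_le` at `67 = 66(1 + 1/66)`,
  `71 = 72(1 − 1/72)` (7 terms) with `log 2` (d20), `log 3` (Mathlib, 1e-10), `log 11` (1e-11, `SemilocalLogAtoms`);
* `√67, √71` by squaring sixteen-digit decimals;
* atoms `atomSixtySeven, atomSeventyOne` and the generic enclosure lemmas `atomSixtySeven_encl (h : 67 ∈ S)`, ….

Folklore numerics throughout; nothing here bears on RH.
-/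

set_option autoImplicit false
set_option linter.dupNamespace false  -- the mandated namespace repeats `RiemannHypothesis`

noncomputable section

namespace Summit.RiemannHypothesis.RiemannHypothesis.Theorems.SemilocalPolyWitness

open Real
open Literature.NumberTheory.LFunctions
open Literature.Analysis.SpecialFunctions.Real
open Summit.RiemannHypothesis.RiemannHypothesis.Theorems.MotivicDoor.SemilocalMarkov

/-! ### The atom `67` (`log 67` from `67 = 66·(1 + 1/66)`) -/

/-- `(4.20469261928) < log 67` (`Real.abs_log_sub_add_sum_range_le` at `x = -1/66`, 7 terms). -/
theorem log_sixtyseven_gt : (4.20469261928 : ℝ) < Real.log 67 := by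
  have t : |(-(1 : ℝ) / 66)| < 1 := by rw [abs_of_neg (by norm_num)]; norm_num
  have z := Real.abs_log_sub_add_sum_range_le t 7
  rw [show |(-(1 : ℝ) / 66)| = 1 / 66 by rw [abs_of_neg (by norm_num)]; norm_num] at z
  norm_num [Finset.sum_range_succ] at z
  have e : Real.log (67 / 66) = Real.log 67 - (Real.log 2 + Real.log 3 + Real.log 11) := by
    rw [Real.log_div (by norm_num) (by norm_num), show (66 : ℝ) = 2 * 3 * 11 by norm_num,
      Real.log_mul (by norm_num) (by norm_num), Real.log_mul (by norm_num) (by norm_num)]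
  rw [e] at z
  have h2 := Literature.Analysis.SpecialFunctions.Real.log_two_gt_d20
  have h3 := logThreeLo_le
  rw [logThreeLo] at h3
  push_cast at h3
  have h11 := logElevenLo_le
  rw [logElevenLo] at h11
  push_cast at h11
  obtain ⟨z1, z2⟩ := abs_le.1 z
  linarith

/-- `log 67 < 4.20469261950` (`Real.abs_log_sub_add_sum_range_le` at `x = -1/66`, 7 terms). -/
theorem log_sixtyseven_lt : Real.log 67 < 4.20469261950 := by
  have t : |(-(1 : ℝ) / 66)| < 1 := by rw [abs_of_neg (by norm_num)]; norm_num
  have z := Real.abs_log_sub_add_sum_range_le t 7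
  rw [show |(-(1 : ℝ) / 66)| = 1 / 66 by rw [abs_of_neg (by norm_num)]; norm_num] at z
  norm_num [Finset.sum_range_succ] at z
  have e : Real.log (67 / 66) = Real.log 67 - (Real.log 2 + Real.log 3 + Real.log 11) := by
    rw [Real.log_div (by norm_num) (by norm_num), show (66 : ℝ) = 2 * 3 * 11 by norm_num,
      Real.log_mul (by norm_num) (by norm_num), Real.log_mul (by norm_num) (by norm_num)]
  rw [e] at z
  have h2 := Literature.Analysis.SpecialFunctions.Real.log_two_lt_d20
  have h3 := log_three_le_logThreeHi
  rw [logThreeHi] at h3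
  push_cast at h3
  have h11 := log_eleven_le_logElevenHi
  rw [logElevenHi] at h11
  push_cast at h11
  obtain ⟨z1, z2⟩ := abs_le.1 z
  linarith

/-- lower decimal of `log 67` -/
def logSixtySevenLo : ℚ := 420469261928 / 100000000000
/-- upper decimal of `log 67` -/
def logSixtySevenHi : ℚ := 420469261950 / 100000000000
/-- `logSixtySevenLo ≤ log 67`. -/
theorem logSixtySevenLo_le : (logSixtySevenLo : ℝ) ≤ Real.log 67 := by
  rw [logSixtySevenLo]; push_cast; linarith [log_sixtyseven_gt]
/-- `log 67 ≤ logSixtySevenHi`. -/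
theorem log_sixtyseven_le_logSixtySevenHi : Real.log 67 ≤ (logSixtySevenHi : ℝ) := by
  rw [logSixtySevenHi]; push_cast; linarith [log_sixtyseven_lt]
/-- `8.1853527718724499 ≤ √67 ≤ 8.18535277187245`. -/
def sqrtSixtySevenLo : ℚ := 81853527718724499 / 10000000000000000
/-- upper decimal of `√67` -/
def sqrtSixtySevenHi : ℚ := 81853527718724500 / 10000000000000000
/-- The atom `67`: weight `log 67/√67`. -/
def atomSixtySeven : ℕ × AtomQ :=
  (67, ⟨logSixtySevenLo, logSixtySevenHi, logSixtySevenLo / sqrtSixtySevenHi, logSixtySevenHi / sqrtSixtySevenLo⟩)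
/-- `atomSixtySeven` encloses the atom `67` for any `S ∋ 67`. -/
theorem atomSixtySeven_encl {S : Finset ℕ} (h : 67 ∈ S) :
    (atomSixtySeven.2.lo : ℝ) ≤ Real.log atomSixtySeven.1 ∧ Real.log atomSixtySeven.1 ≤ (atomSixtySeven.2.hi : ℝ) ∧
      (atomSixtySeven.2.wlo : ℝ) ≤ weilSemilocalCoeff S atomSixtySeven.1 ∧
      weilSemilocalCoeff S atomSixtySeven.1 ≤ (atomSixtySeven.2.whi : ℝ) := by
  simp only [atomSixtySeven]
  push_cast
  have h0 := prime_atom_encl (by norm_num : Nat.Prime 67) h (lo := logSixtySevenLo) (hi := logSixtySevenHi)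
    (slo := sqrtSixtySevenLo) (shi := sqrtSixtySevenHi) (by exact_mod_cast logSixtySevenLo_le)
    (by exact_mod_cast log_sixtyseven_le_logSixtySevenHi) (by rw [logSixtySevenLo]; norm_num)
    (ratCast_le_sqrt (by rw [sqrtSixtySevenLo]; norm_num) (by rw [sqrtSixtySevenLo]; norm_num))
    (sqrt_le_ratCast (by rw [sqrtSixtySevenHi]; norm_num) (by rw [sqrtSixtySevenHi]; norm_num))
    (by rw [sqrtSixtySevenLo]; norm_num)
  push_cast at h0
  exact h0

/-! ### The atom `71` (`log 71` from `71 = 72·(1 − 1/72)`) -/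

/-- `(4.26267987684) < log 71` (`Real.abs_log_sub_add_sum_range_le` at `x = 1/72`, 7 terms). -/
theorem log_seventyone_gt : (4.26267987684 : ℝ) < Real.log 71 := by
  have t : |((1 : ℝ) / 72)| < 1 := by rw [abs_of_pos (by norm_num)]; norm_num
  have z := Real.abs_log_sub_add_sum_range_le t 7
  rw [abs_of_pos (by norm_num : (0 : ℝ) < 1 / 72)] at z
  norm_num [Finset.sum_range_succ] at z
  have e : Real.log (71 / 72) = Real.log 71 - (3 * Real.log 2 + 2 * Real.log 3) := by
    rw [Real.log_div (by norm_num) (by norm_num), show (72 : ℝ) = 2 ^ 3 * 3 ^ 2 by norm_num,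
      Real.log_mul (by norm_num) (by norm_num), Real.log_pow, Real.log_pow]
    push_cast; ring
  rw [e] at z
  have h2 := Literature.Analysis.SpecialFunctions.Real.log_two_gt_d20
  have h3 := logThreeLo_le
  rw [logThreeLo] at h3
  push_cast at h3
  obtain ⟨z1, z2⟩ := abs_le.1 z
  linarith

/-- `log 71 < 4.26267987725` (`Real.abs_log_sub_add_sum_range_le` at `x = 1/72`, 7 terms). -/
theorem log_seventyone_lt : Real.log 71 < 4.26267987725 := by
  have t : |((1 : ℝ) / 72)| < 1 := by rw [abs_of_pos (by norm_num)]; norm_num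
  have z := Real.abs_log_sub_add_sum_range_le t 7
  rw [abs_of_pos (by norm_num : (0 : ℝ) < 1 / 72)] at z
  norm_num [Finset.sum_range_succ] at z
  have e : Real.log (71 / 72) = Real.log 71 - (3 * Real.log 2 + 2 * Real.log 3) := by
    rw [Real.log_div (by norm_num) (by norm_num), show (72 : ℝ) = 2 ^ 3 * 3 ^ 2 by norm_num,
      Real.log_mul (by norm_num) (by norm_num), Real.log_pow, Real.log_pow]
    push_cast; ring
  rw [e] at z
  have h2 := Literature.Analysis.SpecialFunctions.Real.log_two_lt_d20
  have h3 := log_three_le_logThreeHi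
  rw [logThreeHi] at h3
  push_cast at h3
  obtain ⟨z1, z2⟩ := abs_le.1 z
  linarith

/-- lower decimal of `log 71` -/
def logSeventyOneLo : ℚ := 426267987684 / 100000000000
/-- upper decimal of `log 71` -/
def logSeventyOneHi : ℚ := 426267987725 / 100000000000
/-- `logSeventyOneLo ≤ log 71`. -/
theorem logSeventyOneLo_le : (logSeventyOneLo : ℝ) ≤ Real.log 71 := by
  rw [logSeventyOneLo]; push_cast; linarith [log_seventyone_gt]
/-- `log 71 ≤ logSeventyOneHi`. -/
theorem log_seventyone_le_logSeventyOneHi : Real.log 71 ≤ (logSeventyOneHi : ℝ) := by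
  rw [logSeventyOneHi]; push_cast; linarith [log_seventyone_lt]
/-- `8.4261497731763586 ≤ √71 ≤ 8.4261497731763587`. -/
def sqrtSeventyOneLo : ℚ := 84261497731763586 / 10000000000000000
/-- upper decimal of `√71` -/
def sqrtSeventyOneHi : ℚ := 84261497731763587 / 10000000000000000
/-- The atom `71`: weight `log 71/√71`. -/
def atomSeventyOne : ℕ × AtomQ :=
  (71, ⟨logSeventyOneLo, logSeventyOneHi, logSeventyOneLo / sqrtSeventyOneHi, logSeventyOneHi / sqrtSeventyOneLo⟩)
/-- `atomSeventyOne` encloses the atom `71` for any `S ∋ 71`. -/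
theorem atomSeventyOne_encl {S : Finset ℕ} (h : 71 ∈ S) :
    (atomSeventyOne.2.lo : ℝ) ≤ Real.log atomSeventyOne.1 ∧ Real.log atomSeventyOne.1 ≤ (atomSeventyOne.2.hi : ℝ) ∧
      (atomSeventyOne.2.wlo : ℝ) ≤ weilSemilocalCoeff S atomSeventyOne.1 ∧
      weilSemilocalCoeff S atomSeventyOne.1 ≤ (atomSeventyOne.2.whi : ℝ) := by
  simp only [atomSeventyOne]
  push_cast
  have h0 := prime_atom_encl (by norm_num : Nat.Prime 71) h (lo := logSeventyOneLo) (hi := logSeventyOneHi)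
    (slo := sqrtSeventyOneLo) (shi := sqrtSeventyOneHi) (by exact_mod_cast logSeventyOneLo_le)
    (by exact_mod_cast log_seventyone_le_logSeventyOneHi) (by rw [logSeventyOneLo]; norm_num)
    (ratCast_le_sqrt (by rw [sqrtSeventyOneLo]; norm_num) (by rw [sqrtSeventyOneLo]; norm_num))
    (sqrt_le_ratCast (by rw [sqrtSeventyOneHi]; norm_num) (by rw [sqrtSeventyOneHi]; norm_num))
    (by rw [sqrtSeventyOneLo]; norm_num)
  push_cast at h0
  exact h0

end Summit.RiemannHypothesis.RiemannHypothesis.Theorems.SemilocalPolyWitness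

end
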